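import Summits.FinalStateConjecture.FinalStateConjecture.Theorems.SwallowTheDatumSubdataDevelopmentsEmbedDoDCausal
import Literature.Geometry.Lorentzian.CausalityAchronalProofs

/-!
# Route SwallowTheDatum · item `SubdataDevelopmentsEmbed` (stmt-FinalStateConjecture-10053) —
# towards `hncb`, IV: causal convexity of the domain of dependence of `K ⊆ Σ`

For a Cauchy hypersurface `Σ` and `K ⊆ Σ`, with
`D(K) = {x | every endless timelike curve through x meets K}` (inline, no definition):
if `x ∈ D(K)` and `y ≪ x` with `y ∈ I⁺(Σ)`, then `y ∈ D(K)` (`mem_DoD_of_mem_chronologicalFuture`);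
dually for `x ≪ y`, `y ∈ I⁻(Σ)` (`mem_DoD_of_mem_chronologicalPast`). Proof: an endless timelike
curve through `y` crosses `Σ` at a point `z` before `y` (it cannot cross at or after `y`, `Σ`
being achronal and `y ∈ I⁺(Σ)`); then `z ≪ y ≪ x`, a future timelike curve from `z` to `x`
(`mem_chronologicalFuture_trans`) extends to an endless timelike curve through `z` and `x`
(`exists_isEndlessTimelikeCurve_extends`), which meets `K ⊆ Σ` since `x ∈ D(K)` and meets `Σ` only
once — at `z`; so `z ∈ K`. Hawking–Ellis 1973, §6.5 (p. 201: `D⁺(S)` and the causal structure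
below its points); O'Neill 1983, Ch. 14, Lemma 14.29 ff. A step of the horizon argument for `hncb`
(points below a point of `D(K)` stay in `D(K)`).

No definition, no named fact.
-/

noncomputable section

open Function Set Filter Topology TopologicalSpace Bundle Manifold
open scoped Manifold ContDiff Topology

namespace Summit.FinalStateConjecture.FinalStateConjecture.Theorems

namespace SubdataDevelopmentsEmbed

open Literature.Geometry.Lorentzian

section Convex

variable {E : Type*} [NormedAddCommGroup E] [NormedSpace ℝ E] {H : Type*} [TopologicalSpace H]
  {I : ModelWithCorners ℝ E H} {n : ℕ∞ω} {M : Type*} [TopologicalSpace M] [ChartedSpace H M]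
  [IsManifold I ∞ M] {g : LorentzianMetric I n M} {τ : TimeOrientation g}
  [T2Space M] [SecondCountableTopology M] [BoundarylessManifold I M] [FiniteDimensional ℝ E]

/-- **Past causal convexity of `D(K)` above `Σ`.** If `x ∈ D(K)` (`K ⊆ Σ`, `Σ` a Cauchy
hypersurface), `y ≪ x` and `y ∈ I⁺(Σ)`, then `y ∈ D(K)`. Hawking–Ellis 1973, §6.5. -/
theorem mem_DoD_of_mem_chronologicalFuture (hn : 2 ≤ n) {Sig K : Set M}
    (hSig : g.IsCauchyHypersurface τ Sig) (hK : K ⊆ Sig) {x y : M}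
    (hx : ∀ (δ : ℝ → M) (u : Set ℝ), g.IsEndlessTimelikeCurve τ δ u →
      ∀ r ∈ u, δ r = x → ∃ r' ∈ u, δ r' ∈ K)
    (hxy : x ∈ g.chronologicalFuture τ {y}) (hy : y ∈ g.chronologicalFuture τ Sig) :
    ∀ (δ : ℝ → M) (u : Set ℝ), g.IsEndlessTimelikeCurve τ δ u →
      ∀ r ∈ u, δ r = y → ∃ r' ∈ u, δ r' ∈ K := by
  intro σ v hσ r hr hσr
  obtain ⟨tS, ⟨htS, hσtS⟩, -⟩ := hSig σ v hσ
  rcases lt_trichotomy tS r with hlt | heq | hgt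
  · -- the crossing `z = σ t*` is before `y`; `z ≪ y ≪ x`
    refine ⟨tS, htS, ?_⟩
    have hzy : y ∈ g.chronologicalFuture τ {σ tS} :=
      ⟨σ tS, rfl, σ, tS, r, hlt, hσ.2.1.mono (hσ.1.out htS hr), rfl, hσr⟩
    obtain ⟨z, hz, Γ, a, b, hab, hΓ, hΓa, hΓb⟩ :=
      LorentzianMetric.mem_chronologicalFuture_trans hzy hxy
    rw [mem_singleton_iff] at hz
    obtain ⟨Δ, D, hΔ, haD, hbD, hΔa, hΔb⟩ :=
      LorentzianMetric.exists_isEndlessTimelikeCurve_extends hn hab hΓ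
    obtain ⟨r', hr'D, hr'K⟩ := hx Δ D hΔ b hbD (by rw [hΔb, hΓb])
    obtain ⟨t₁, -, huniq⟩ := hSig Δ D hΔ
    have e1 : r' = t₁ := huniq r' ⟨hr'D, hK hr'K⟩
    have e2 : a = t₁ := huniq a ⟨haD, by rw [hΔa, hΓa, hz]; exact hσtS⟩
    rw [← hz, ← hΓa, ← hΔa, e2, ← e1]
    exact hr'K
  · -- crossing at `y`: impossible, `y ∈ I⁺(Σ)` is not on `Σ`
    subst heq
    exact absurd (hσr ▸ hσtS) (not_mem_of_mem_chronologicalFuture hn hSig hy)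
  · -- crossing after `y`: `y ≪ σ t* ∈ Σ` with `y ∈ I⁺(Σ)`, against achronality
    have h1 : σ tS ∈ g.chronologicalFuture τ {y} :=
      ⟨y, rfl, σ, r, tS, hgt, hσ.2.1.mono (hσ.1.out hr htS), hσr, rfl⟩
    have h2 : σ tS ∈ g.chronologicalFuture τ Sig :=
      LorentzianMetric.mem_chronologicalFuture_trans hy h1
    exact absurd hσtS (not_mem_of_mem_chronologicalFuture hn hSig h2)

/-- **Future causal convexity of `D(K)` below `Σ`** (time dual): if `x ∈ D(K)`, `x ≪ y` and
`y ∈ I⁻(Σ)`, then `y ∈ D(K)`. Hawking–Ellis 1973, §6.5. -/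
theorem mem_DoD_of_mem_chronologicalPast (hn : 2 ≤ n) {Sig K : Set M}
    (hSig : g.IsCauchyHypersurface τ Sig) (hK : K ⊆ Sig) {x y : M}
    (hx : ∀ (δ : ℝ → M) (u : Set ℝ), g.IsEndlessTimelikeCurve τ δ u →
      ∀ r ∈ u, δ r = x → ∃ r' ∈ u, δ r' ∈ K)
    (hxy : y ∈ g.chronologicalFuture τ {x}) (hy : y ∈ g.chronologicalPast τ Sig) :
    ∀ (δ : ℝ → M) (u : Set ℝ), g.IsEndlessTimelikeCurve τ δ u →
      ∀ r ∈ u, δ r = y → ∃ r' ∈ u, δ r' ∈ K := by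
  intro σ v hσ r hr hσr
  obtain ⟨tS, ⟨htS, hσtS⟩, -⟩ := hSig σ v hσ
  rcases lt_trichotomy r tS with hlt | heq | hgt
  · -- the crossing `z = σ t*` is after `y`; `x ≪ y ≪ z`
    refine ⟨tS, htS, ?_⟩
    have hyz : σ tS ∈ g.chronologicalFuture τ {y} :=
      ⟨y, rfl, σ, r, tS, hlt, hσ.2.1.mono (hσ.1.out hr htS), hσr, rfl⟩
    obtain ⟨x', hx', Γ, a, b, hab, hΓ, hΓa, hΓb⟩ :=
      LorentzianMetric.mem_chronologicalFuture_trans hxy hyz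
    rw [mem_singleton_iff] at hx'
    obtain ⟨Δ, D, hΔ, haD, hbD, hΔa, hΔb⟩ :=
      LorentzianMetric.exists_isEndlessTimelikeCurve_extends hn hab hΓ
    obtain ⟨r', hr'D, hr'K⟩ := hx Δ D hΔ a haD (by rw [hΔa, hΓa, hx'])
    obtain ⟨t₁, -, huniq⟩ := hSig Δ D hΔ
    have e1 : r' = t₁ := huniq r' ⟨hr'D, hK hr'K⟩
    have e2 : b = t₁ := huniq b ⟨hbD, by rw [hΔb, hΓb]; exact hσtS⟩
    rw [← hΓb, ← hΔb, e2, ← e1]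
    exact hr'K
  · subst heq
    exact absurd (hσr ▸ hσtS) (not_mem_of_mem_chronologicalPast hn hSig hy)
  · -- crossing before `y`: `σ t* ≪ y` with `y ∈ I⁻(Σ)`, against achronality
    have h1 : y ∈ g.chronologicalFuture τ {σ tS} :=
      ⟨σ tS, rfl, σ, tS, r, hgt, hσ.2.1.mono (hσ.1.out htS hr), rfl, hσr⟩
    have h2 : σ tS ∈ g.chronologicalPast τ Sig :=
      LorentzianMetric.mem_chronologicalFuture_trans (τ := τ.reverse) hy
        (LorentzianMetric.mem_chronologicalPast_of_mem_chronologicalFuture h1)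
    exact absurd hσtS (not_mem_of_mem_chronologicalPast hn hSig h2)

end Convex

end SubdataDevelopmentsEmbed

end Summit.FinalStateConjecture.FinalStateConjecture.Theorems

end
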